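import Summits.AtomisticToContinuum.Crystallization.Theorems.ShellCensus.Negative.MatchingDegree

/-!
# `ShellCensus` (stmt-AtomisticToContinuum-15929), negative side II: the decahedral pattern has only two poles

The third census pattern of `GappedShellCensus.ShellCensus` is the decahedral-axis shell
(bicapped pentagonal prism), inlined in the statement as
`(univ.image up ∪ univ.image lo) ∪ {pN, pS}` with ring points
`!₂[√3/2 cos(2πk/5), √3/2 sin(2πk/5), ±1/2]` and poles `!₂[0, 0, ±1]` (`decPat`, definitionally the
statement's expression: `decPat_eq`).  We prove:

* ring points have at most FOUR other pattern points within `1.426` (pole, prism partner, two ring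
  neighbours; every other pattern point is `≥ √((23 − 3√5)/8) = 1.42705…` away, from
  `cos 72° = (√5 − 1)/4`, `cos 144° = −(1 + √5)/4`): `card_near_up`, `card_near_lo`,
  `pole_of_five_near`;
* the POLE OBSTRUCTION `not_shellCloseTo_dec`: a shell with three distinct points each having five
  other shell points within `β`, `β + 2η < 1.426`, is not `η`-close to `decPat` (three such points
  would be injected into the two poles).

Negative-side support (no route item is concluded positively); refuter seat
refuter-rattack-stmt-AtomisticToContinuum-15929-0, 2026-08-16.
-/

noncomputable section

namespace Summit.AtomisticToContinuum.Crystallization.Theorems.ShellCensusNegative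

open Literature.Geometry.DiscreteGeometry

/-- upper pentagon point `k` of the decahedral-axis pattern, written exactly as in the route
statement. [folklore] -/
def up (k : Fin 5) : (EuclideanSpace ℝ (Fin 3)) :=
  !₂[Real.sqrt 3 / 2 * Real.cos (2 * Real.pi * k / 5), Real.sqrt 3 / 2 * Real.sin (2 * Real.pi * k / 5), (1 : ℝ) / 2]

/-- lower pentagon point `k` of the decahedral-axis pattern. [folklore] -/
def lo (k : Fin 5) : (EuclideanSpace ℝ (Fin 3)) :=
  !₂[Real.sqrt 3 / 2 * Real.cos (2 * Real.pi * k / 5), Real.sqrt 3 / 2 * Real.sin (2 * Real.pi * k / 5), -(1 : ℝ) / 2]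

/-- north pole of the decahedral-axis pattern. [folklore] -/
def pN : (EuclideanSpace ℝ (Fin 3)) := !₂[(0 : ℝ), 0, 1]

/-- south pole of the decahedral-axis pattern. [folklore] -/
def pS : (EuclideanSpace ℝ (Fin 3)) := !₂[(0 : ℝ), 0, -1]

/-- the decahedral-axis pattern (bicapped pentagonal prism) of the statement. [folklore] -/
def decPat : Finset (EuclideanSpace ℝ (Fin 3)) :=
  (Finset.univ.image up ∪ Finset.univ.image lo) ∪ {pN, pS}

/-- `decPat` is, definitionally, the decahedral-axis pattern inlined in `ShellCensus`. [folklore] -/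
theorem decPat_eq : decPat = ((Finset.univ.image fun k : Fin 5 => !₂[Real.sqrt 3 / 2 * Real.cos (2 * Real.pi * k / 5), Real.sqrt 3 / 2 * Real.sin (2 * Real.pi * k / 5), (1 : ℝ) / 2]) ∪ (Finset.univ.image fun k : Fin 5 => !₂[Real.sqrt 3 / 2 * Real.cos (2 * Real.pi * k / 5), Real.sqrt 3 / 2 * Real.sin (2 * Real.pi * k / 5), -(1 : ℝ) / 2]) ∪ {!₂[(0 : ℝ), 0, 1], !₂[(0 : ℝ), 0, -1]}) :=
  rfl

/-- squared distance of two explicit points of `ℝ³`. [folklore] -/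
theorem dist_sq_mk3 (a b c a' b' c' : ℝ) :
    dist (!₂[a, b, c] : (EuclideanSpace ℝ (Fin 3))) !₂[a', b', c'] ^ 2 = (a - a') ^ 2 + (b - b') ^ 2 + (c - c') ^ 2 := by
  rw [EuclideanSpace.dist_eq, Real.sq_sqrt (by positivity), Fin.sum_univ_three]
  simp [Real.dist_eq, sq_abs]

/-- squared distance of two ring points in cylindrical form: `3/2 (1 − cos Δθ) + Δz²`. [folklore] -/
theorem dist_sq_polar (θ θ' z z' : ℝ) :
    dist (!₂[Real.sqrt 3 / 2 * Real.cos θ, Real.sqrt 3 / 2 * Real.sin θ, z] : (EuclideanSpace ℝ (Fin 3)))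
      !₂[Real.sqrt 3 / 2 * Real.cos θ', Real.sqrt 3 / 2 * Real.sin θ', z']  ^ 2
      = 3 / 2 * (1 - Real.cos (θ - θ')) + (z - z') ^ 2 := by
  rw [dist_sq_mk3, Real.cos_sub]
  have h3 : Real.sqrt 3 ^ 2 = 3 := Real.sq_sqrt (by norm_num)
  nlinarith [Real.cos_sq_add_sin_sq θ, Real.cos_sq_add_sin_sq θ']

/-- squared distance of a ring point to an axis point: `3/4 + Δz²`. [folklore] -/
theorem dist_sq_polar_pole (θ z z' : ℝ) :
    dist (!₂[Real.sqrt 3 / 2 * Real.cos θ, Real.sqrt 3 / 2 * Real.sin θ, z] : (EuclideanSpace ℝ (Fin 3))) !₂[(0 : ℝ), 0, z'] ^ 2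
      = 3 / 4 + (z - z') ^ 2 := by
  rw [dist_sq_mk3]
  have h3 : Real.sqrt 3 ^ 2 = 3 := Real.sq_sqrt (by norm_num)
  nlinarith [Real.cos_sq_add_sin_sq θ]

open Real in
/-- `cos 72° = (√5 − 1)/4`. [folklore] -/
theorem cos_two_pi_div_five' : Real.cos (2 * π / 5) = (Real.sqrt 5 - 1) / 4 := by
  have h : 2 * π / 5 = 2 * (π / 5) := by ring
  rw [h, Real.cos_two_mul, Real.cos_pi_div_five]
  have h5 : Real.sqrt 5 ^ 2 = 5 := Real.sq_sqrt (by norm_num)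
  nlinarith [h5]

open Real in
/-- `cos 144° = −(1 + √5)/4`. [folklore] -/
theorem cos_four_pi_div_five' : Real.cos (4 * π / 5) = -((1 + Real.sqrt 5) / 4) := by
  have h : 4 * π / 5 = π - π / 5 := by ring
  rw [h, Real.cos_pi_sub, Real.cos_pi_div_five]

open Real in
/-- `cos 216° = −(1 + √5)/4`. [folklore] -/
theorem cos_six_pi_div_five' : Real.cos (6 * π / 5) = -((1 + Real.sqrt 5) / 4) := by
  have h : 6 * π / 5 = π / 5 + π := by ring
  rw [h, Real.cos_add_pi, Real.cos_pi_div_five]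

open Real in
/-- `cos 288° = (√5 − 1)/4`. [folklore] -/
theorem cos_eight_pi_div_five' : Real.cos (8 * π / 5) = (Real.sqrt 5 - 1) / 4 := by
  have h : 8 * π / 5 = 2 * π - 2 * π / 5 := by ring
  rw [h, Real.cos_two_pi_sub, cos_two_pi_div_five']

open Real in
/-- for distinct pentagon indices the angular difference has cosine `≤ cos 72° = (√5 − 1)/4` [folklore] -/
theorem cos_diff_le (k j : Fin 5) (h : k ≠ j) :
    Real.cos (2 * Real.pi * k / 5 - 2 * Real.pi * j / 5) ≤ (Real.sqrt 5 - 1) / 4 := by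
  have hs : 0 ≤ Real.sqrt 5 := Real.sqrt_nonneg 5
  have key : ∀ m : ℝ, (m = 1 ∨ m = -1 ∨ m = 4 ∨ m = -4) ∨ (m = 2 ∨ m = -2 ∨ m = 3 ∨ m = -3) →
      Real.cos (2 * Real.pi * m / 5) ≤ (Real.sqrt 5 - 1) / 4 := by
    intro m hm
    rcases hm with (rfl | rfl | rfl | rfl) | (rfl | rfl | rfl | rfl)
    · rw [show 2 * π * (1:ℝ) / 5 = 2 * π / 5 by ring, cos_two_pi_div_five']
    · rw [show 2 * π * (-1:ℝ) / 5 = -(2 * π / 5) by ring, Real.cos_neg, cos_two_pi_div_five']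
    · rw [show 2 * π * (4:ℝ) / 5 = 8 * π / 5 by ring, cos_eight_pi_div_five']
    · rw [show 2 * π * (-4:ℝ) / 5 = -(8 * π / 5) by ring, Real.cos_neg, cos_eight_pi_div_five']
    · rw [show 2 * π * (2:ℝ) / 5 = 4 * π / 5 by ring, cos_four_pi_div_five']; linarith
    · rw [show 2 * π * (-2:ℝ) / 5 = -(4 * π / 5) by ring, Real.cos_neg, cos_four_pi_div_five']; linarith
    · rw [show 2 * π * (3:ℝ) / 5 = 6 * π / 5 by ring, cos_six_pi_div_five']; linarith
    · rw [show 2 * π * (-3:ℝ) / 5 = -(6 * π / 5) by ring, Real.cos_neg, cos_six_pi_div_five']; linarith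
  have e : 2 * Real.pi * (k : ℝ) / 5 - 2 * Real.pi * (j : ℝ) / 5 = 2 * Real.pi * ((k : ℝ) - j) / 5 := by ring
  rw [e]
  apply key
  fin_cases k <;> fin_cases j <;> simp_all <;> norm_num

open Real in
/-- same-ring indices two apart have cosine `≤ cos 144°` [folklore] -/
theorem cos_diff_le_of_two (k j : Fin 5) (h : k - j = 2 ∨ k - j = 3) :
    Real.cos (2 * Real.pi * k / 5 - 2 * Real.pi * j / 5) ≤ -((1 + Real.sqrt 5) / 4) := by
  have key : ∀ m : ℝ, (m = 2 ∨ m = -2 ∨ m = 3 ∨ m = -3) →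
      Real.cos (2 * Real.pi * m / 5) ≤ -((1 + Real.sqrt 5) / 4) := by
    intro m hm
    rcases hm with rfl | rfl | rfl | rfl
    · rw [show 2 * π * (2:ℝ) / 5 = 4 * π / 5 by ring, cos_four_pi_div_five']
    · rw [show 2 * π * (-2:ℝ) / 5 = -(4 * π / 5) by ring, Real.cos_neg, cos_four_pi_div_five']
    · rw [show 2 * π * (3:ℝ) / 5 = 6 * π / 5 by ring, cos_six_pi_div_five']
    · rw [show 2 * π * (-3:ℝ) / 5 = -(6 * π / 5) by ring, Real.cos_neg, cos_six_pi_div_five']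
  have e : 2 * Real.pi * (k : ℝ) / 5 - 2 * Real.pi * (j : ℝ) / 5 = 2 * Real.pi * ((k : ℝ) - j) / 5 := by ring
  rw [e]
  apply key
  fin_cases k <;> fin_cases j <;> first | exact absurd h (by decide) | (simp <;> norm_num)

/-- `2.236 ≤ √5 ≤ 2.2361`. [folklore] -/
theorem sqrt5_bounds : (2.236 : ℝ) ≤ Real.sqrt 5 ∧ Real.sqrt 5 ≤ 2.2361 := by
  constructor
  · calc (2.236 : ℝ) = Real.sqrt (2.236 ^ 2) := (Real.sqrt_sq (by norm_num)).symm
      _ ≤ Real.sqrt 5 := Real.sqrt_le_sqrt (by norm_num)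
  · calc Real.sqrt 5 ≤ Real.sqrt (2.2361 ^ 2) := Real.sqrt_le_sqrt (by norm_num)
      _ = 2.2361 := Real.sqrt_sq (by norm_num)

/-- far pairs of the decahedral pattern (all `≥ 1.426` apart) [folklore] -/
theorem far_up_up (k j : Fin 5) (h : k - j = 2 ∨ k - j = 3) : (1.426 : ℝ) ≤ dist (up k) (up j) := by
  have hd := dist_sq_polar (2 * Real.pi * k / 5) (2 * Real.pi * j / 5) ((1 : ℝ) / 2) ((1 : ℝ) / 2)
  have hc := cos_diff_le_of_two k j h
  have hs := sqrt5_bounds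
  have h2 : (1.426 : ℝ) ^ 2 ≤ dist (up k) (up j) ^ 2 := by unfold up; rw [hd]; nlinarith
  exact (sq_le_sq₀ (by norm_num) dist_nonneg).1 h2

/-- lower-ring points two apart are `≥ 1.426` apart. [folklore] -/
theorem far_lo_lo (k j : Fin 5) (h : k - j = 2 ∨ k - j = 3) : (1.426 : ℝ) ≤ dist (lo k) (lo j) := by
  have hd := dist_sq_polar (2 * Real.pi * k / 5) (2 * Real.pi * j / 5) (-(1 : ℝ) / 2) (-(1 : ℝ) / 2)
  have hc := cos_diff_le_of_two k j h
  have hs := sqrt5_bounds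
  have h2 : (1.426 : ℝ) ^ 2 ≤ dist (lo k) (lo j) ^ 2 := by unfold lo; rw [hd]; nlinarith
  exact (sq_le_sq₀ (by norm_num) dist_nonneg).1 h2

/-- an upper-ring point and a non-partner lower-ring point are `≥ 1.426` apart
(`√((23 − 3√5)/8) = 1.42705…`). [folklore] -/
theorem far_up_lo (k j : Fin 5) (h : k ≠ j) : (1.426 : ℝ) ≤ dist (up k) (lo j) := by
  have hd := dist_sq_polar (2 * Real.pi * k / 5) (2 * Real.pi * j / 5) ((1 : ℝ) / 2) (-(1 : ℝ) / 2)
  have hc := cos_diff_le k j h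
  have hs := sqrt5_bounds
  have h2 : (1.426 : ℝ) ^ 2 ≤ dist (up k) (lo j) ^ 2 := by unfold up lo; rw [hd]; nlinarith
  exact (sq_le_sq₀ (by norm_num) dist_nonneg).1 h2

/-- symmetric form of `far_up_lo`. [folklore] -/
theorem far_lo_up (k j : Fin 5) (h : k ≠ j) : (1.426 : ℝ) ≤ dist (lo k) (up j) := by
  rw [dist_comm]; exact far_up_lo j k (Ne.symm h)

/-- upper-ring points are `√3` from the south pole. [folklore] -/
theorem far_up_S (k : Fin 5) : (1.426 : ℝ) ≤ dist (up k) pS := by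
  have hd := dist_sq_polar_pole (2 * Real.pi * k / 5) ((1 : ℝ) / 2) (-1)
  have h2 : (1.426 : ℝ) ^ 2 ≤ dist (up k) pS ^ 2 := by unfold up pS; rw [hd]; norm_num
  exact (sq_le_sq₀ (by norm_num) dist_nonneg).1 h2

/-- lower-ring points are `√3` from the north pole. [folklore] -/
theorem far_lo_N (k : Fin 5) : (1.426 : ℝ) ≤ dist (lo k) pN := by
  have hd := dist_sq_polar_pole (2 * Real.pi * k / 5) (-(1 : ℝ) / 2) 1
  have h2 : (1.426 : ℝ) ^ 2 ≤ dist (lo k) pN ^ 2 := by unfold lo pN; rw [hd]; norm_num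
  exact (sq_le_sq₀ (by norm_num) dist_nonneg).1 h2

/-- a non-pole point of the upper ring has at most four other pattern points within `1.426` [folklore] -/
theorem card_near_up (k : Fin 5) :
    (decPat.filter fun b => b ≠ up k ∧ dist (up k) b < 1.426).card ≤ 4 := by
  classical
  unfold decPat
  rw [Finset.filter_union, Finset.filter_union]
  have hU : ((Finset.univ.image up).filter fun b => b ≠ up k ∧ dist (up k) b < 1.426)
      ⊆ {up (k + 1), up (k - 1)} := by
    intro b hb
    simp only [Finset.mem_filter, Finset.mem_image, Finset.mem_univ, true_and] at hb
    obtain ⟨⟨j, rfl⟩, hne, hd⟩ := hb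
    have hjk : j ≠ k := by rintro rfl; exact hne rfl
    have comb : ∀ k j : Fin 5, j ≠ k → j = k + 1 ∨ j = k - 1 ∨ (k - j = 2 ∨ k - j = 3) := by
      decide
    have hj := comb k j hjk
    rcases hj with rfl | rfl | h2
    · simp
    · simp
    · have := far_up_up k j h2; linarith
  have hL : ((Finset.univ.image lo).filter fun b => b ≠ up k ∧ dist (up k) b < 1.426) ⊆ {lo k} := by
    intro b hb
    simp only [Finset.mem_filter, Finset.mem_image, Finset.mem_univ, true_and] at hb
    obtain ⟨⟨j, rfl⟩, hne, hd⟩ := hb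
    by_cases hjk : k = j
    · subst hjk; simp
    · have := far_up_lo k j hjk; linarith
  have hP : (({pN, pS} : Finset (EuclideanSpace ℝ (Fin 3))).filter fun b => b ≠ up k ∧ dist (up k) b < 1.426) ⊆ {pN} := by
    intro b hb
    simp only [Finset.mem_filter, Finset.mem_insert, Finset.mem_singleton] at hb
    obtain ⟨hb, hne, hd⟩ := hb
    rcases hb with rfl | rfl
    · simp
    · have := far_up_S k; linarith
  calc _ ≤ ((Finset.univ.image up).filter fun b => b ≠ up k ∧ dist (up k) b < 1.426).card
        + ((Finset.univ.image lo).filter fun b => b ≠ up k ∧ dist (up k) b < 1.426).card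
        + (({pN, pS} : Finset (EuclideanSpace ℝ (Fin 3))).filter fun b => b ≠ up k ∧ dist (up k) b < 1.426).card := by
          refine le_trans (Finset.card_union_le _ _) ?_
          gcongr
          exact Finset.card_union_le _ _
    _ ≤ 2 + 1 + 1 := by
          gcongr
          · exact le_trans (Finset.card_le_card hU) (Finset.card_le_two)
          · exact le_trans (Finset.card_le_card hL) (by simp)
          · exact le_trans (Finset.card_le_card hP) (by simp)

/-- a non-pole point of the lower ring has at most four other pattern points within `1.426` [folklore] -/
theorem card_near_lo (k : Fin 5) :
    (decPat.filter fun b => b ≠ lo k ∧ dist (lo k) b < 1.426).card ≤ 4 := by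
  classical
  unfold decPat
  rw [Finset.filter_union, Finset.filter_union]
  have hU : ((Finset.univ.image up).filter fun b => b ≠ lo k ∧ dist (lo k) b < 1.426) ⊆ {up k} := by
    intro b hb
    simp only [Finset.mem_filter, Finset.mem_image, Finset.mem_univ, true_and] at hb
    obtain ⟨⟨j, rfl⟩, hne, hd⟩ := hb
    by_cases hjk : k = j
    · subst hjk; simp
    · have := far_lo_up k j hjk; linarith
  have hL : ((Finset.univ.image lo).filter fun b => b ≠ lo k ∧ dist (lo k) b < 1.426)
      ⊆ {lo (k + 1), lo (k - 1)} := by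
    intro b hb
    simp only [Finset.mem_filter, Finset.mem_image, Finset.mem_univ, true_and] at hb
    obtain ⟨⟨j, rfl⟩, hne, hd⟩ := hb
    have hjk : j ≠ k := by rintro rfl; exact hne rfl
    have comb : ∀ k j : Fin 5, j ≠ k → j = k + 1 ∨ j = k - 1 ∨ (k - j = 2 ∨ k - j = 3) := by
      decide
    have hj := comb k j hjk
    rcases hj with rfl | rfl | h2
    · simp
    · simp
    · have := far_lo_lo k j h2; linarith
  have hP : (({pN, pS} : Finset (EuclideanSpace ℝ (Fin 3))).filter fun b => b ≠ lo k ∧ dist (lo k) b < 1.426) ⊆ {pS} := by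
    intro b hb
    simp only [Finset.mem_filter, Finset.mem_insert, Finset.mem_singleton] at hb
    obtain ⟨hb, hne, hd⟩ := hb
    rcases hb with rfl | rfl
    · have := far_lo_N k; linarith
    · simp
  calc _ ≤ ((Finset.univ.image up).filter fun b => b ≠ lo k ∧ dist (lo k) b < 1.426).card
        + ((Finset.univ.image lo).filter fun b => b ≠ lo k ∧ dist (lo k) b < 1.426).card
        + (({pN, pS} : Finset (EuclideanSpace ℝ (Fin 3))).filter fun b => b ≠ lo k ∧ dist (lo k) b < 1.426).card := by
          refine le_trans (Finset.card_union_le _ _) ?_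
          gcongr
          exact Finset.card_union_le _ _
    _ ≤ 1 + 2 + 1 := by
          gcongr
          · exact le_trans (Finset.card_le_card hU) (by simp)
          · exact le_trans (Finset.card_le_card hL) (Finset.card_le_two)
          · exact le_trans (Finset.card_le_card hP) (by simp)

/-- In the decahedral pattern only the two poles have five other pattern points within `1.426`. [folklore] -/
theorem pole_of_five_near {a : (EuclideanSpace ℝ (Fin 3))} (ha : a ∈ decPat)
    (h5 : 5 ≤ (decPat.filter fun b => b ≠ a ∧ dist a b < 1.426).card) : a = pN ∨ a = pS := by
  have ha' := ha
  unfold decPat at ha'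
  rcases Finset.mem_union.1 ha' with h | h
  · rcases Finset.mem_union.1 h with h | h
    · obtain ⟨k, -, rfl⟩ := Finset.mem_image.1 h
      have := card_near_up k; omega
    · obtain ⟨k, -, rfl⟩ := Finset.mem_image.1 h
      have := card_near_lo k; omega
  · simpa using h

/-- The pole obstruction: a shell with three distinct points each having five other shell points
within `β`, `β + 2η < 1.426`, is not `η`-close to the decahedral pattern (only two poles). [folklore] -/
theorem not_shellCloseTo_dec {η β : ℝ} {T : Finset (EuclideanSpace ℝ (Fin 3))} (hβ : β + 2 * η < 1.426)
    (t : Fin 3 → (EuclideanSpace ℝ (Fin 3))) (ht : ∀ i, t i ∈ T) (htinj : Function.Injective t)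
    (N : Fin 3 → Finset (EuclideanSpace ℝ (Fin 3))) (hNT : ∀ i, N i ⊆ T) (hN0 : ∀ i, t i ∉ N i)
    (hNcard : ∀ i, (N i).card = 5) (hNd : ∀ i, ∀ u ∈ N i, dist (t i) u ≤ β) :
    ¬ ShellCloseTo η T decPat := by
  classical
  rintro ⟨A, hA⟩
  obtain ⟨f, hfQ, hfinj, hfd⟩ := exists_map_of_etaMatched hA
  have hpole : ∀ i, f (t i) = A pN ∨ f (t i) = A pS := by
    intro i
    have h5 := five_le_card_near f hfQ hfinj hfd hβ (ht i) (N i) (hNT i) (hN0 i) (hNcard i) (hNd i)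
    obtain ⟨a, ha, hfa⟩ := Finset.mem_image.1 (hfQ (t i) (ht i))
    rw [← hfa, card_near_image] at h5
    rcases pole_of_five_near ha h5 with rfl | rfl
    · exact Or.inl hfa.symm
    · exact Or.inr hfa.symm
  have key : ∃ i j : Fin 3, i ≠ j ∧ f (t i) = f (t j) := by
    rcases hpole 0 with h0 | h0 <;> rcases hpole 1 with h1 | h1 <;> rcases hpole 2 with h2 | h2 <;>
      first
        | exact ⟨0, 1, by decide, h0.trans h1.symm⟩
        | exact ⟨0, 2, by decide, h0.trans h2.symm⟩
        | exact ⟨1, 2, by decide, h1.trans h2.symm⟩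
  obtain ⟨i, j, hij, hEq⟩ := key
  exact hij (htinj (hfinj _ (ht i) _ (ht j) hEq))

end Summit.AtomisticToContinuum.Crystallization.Theorems.ShellCensusNegative

end
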